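import Summits.Parity.GeneralizedHardyLittlewood.Theorems.Dhl42KernelJ1
import Summits.Parity.GeneralizedHardyLittlewood.Theorems.Dhl42DataH40
import Summits.Parity.GeneralizedHardyLittlewood.Theorems.Dhl42DataFJ2
import Summits.Parity.GeneralizedHardyLittlewood.Theorems.Dhl42DataFJ3
import Literature.Analysis.ValidatedNumerics.ExpPoly.ToExpSum
import Summits.Parity.GeneralizedHardyLittlewood.Theorems.Dhl42MainTermsData

/-!
# DHL[42,2] certificate — kernel verification of pairings 2 and 3 of `J^K(F₀)` and of the total against `jkTerms`

`decide +kernel` evaluations of the `J`-side pairings whose densities are built on the literal `H40`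
(pairing 2 = class B: `gh ⋆ G^{⋆40}` against `𝖠𝖡 = WPQ`, six slices; pairing 3 = class C:
`h² ⋆ G^{⋆40}` against `𝖡² = WQ2`, three slices), the bookkeeping `WPQ_slices`, the reassembled
evaluations `pJ2`, `pJ3`, and the kernel identity `Jtot`: the total of the four pairings with
multiplicities `42·(1, 82, 41, 1640)` is, as a normalised formal sum, the 113-term exact value
`jkTerms` of `Dhl42MainTermsData`. Kernel time ≈ 128 + 43 + 14 s.

Origin: `Dhl42/ClosedForm/KernelJ.lean` of the DHL[42,2] certificate package (pub-dhl42 bundle,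
archive blob `18cce9e3`; sha256[:16] of the file `f0a41fa39bb72905`; paper snapshot =
`paper/main.tex` v1), lines :48–:74, :93–:100, :104–:109, :118–:121; statements and proofs unchanged
except: namespace `Dhl42.ClosedForm` →
`Summit.Parity.GeneralizedHardyLittlewood.Theorems.Dhl42.ClosedForm`, `Dhl42.ExpPoly` → the tree's
`Literature.Analysis.ValidatedNumerics.ExpPoly` (`ExpPoly/*.lean`, batch B1),
`Dhl42.ClosedForm.Eterms` → the tree's `Literature.Analysis.ValidatedNumerics.ExpPoly.ToExpSum`
(`etermsFS`, batch B1); `Dhl42.MainTermsData.*` resolves to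
`Summit.Parity.GeneralizedHardyLittlewood.Theorems.Dhl42.MainTermsData.*` unchanged, docstrings
added where missing (the docstring of `Jtot` re-worded for the tree: package-internal pointers
removed, mathematics unchanged).

Declarations (15): `pJ2s0`, `pJ2s1`, `pJ2s3`, `pJ2s7`, `pJ2s16`, `pJ2s21`, `pJ3s0`, `pJ3s1`,
`pJ3s3`, `WPQ_slices`, `FJ2all`, `pJ2`, `FJ3all`, `pJ3`, `Jtot`.
-/

-- `decide +kernel` below: the `Decidable` instances unfold `EP.canon` / `EP.conv` / `FS.norm` structurally over lists of
-- hundreds of blocks with GMP-size rationals (deep recursion), and each kernel evaluation runs for 5–60 s on the package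
-- toolchain — heartbeats meter only the elaborator's share, which must not abort a check the kernel completes
set_option maxRecDepth 100000
set_option maxHeartbeats 0

open Literature.Analysis.ValidatedNumerics.ExpPoly

namespace Summit.Parity.GeneralizedHardyLittlewood.Theorems.Dhl42.ClosedForm

/-- Kernel evaluation, `J`-side pairing 2 (class B: one factor `gh`), slice `[0, 1)` (blocks of the
weight): the normalised pairing of the density `canon (GHE ⋆ H40)` with the blocks `[0, 1)` of
`𝖠𝖡 = WPQ` on `[0, K]` is the literal `FJ2s0` (`decide +kernel` recomputes the left-hand side; each
pairing is sliced by blocks of its weight so that every kernel check stays well under a minute). -/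
theorem pJ2s0 : FS.norm (pairLo (EP.canon (EP.conv GHE H40)) ((WPQ.drop 0).take 1)) = FJ2s0 := by
  decide +kernel

/-- Slice `[1, 3)` of `J`-side pairing 2 (density `canon (GHE ⋆ H40)`, weight `WPQ`): normalised
value = the literal `FJ2s1` (kernel evaluation). -/
theorem pJ2s1 : FS.norm (pairLo (EP.canon (EP.conv GHE H40)) ((WPQ.drop 1).take 2)) = FJ2s1 := by
  decide +kernel

/-- Slice `[3, 7)` of `J`-side pairing 2 (density `canon (GHE ⋆ H40)`, weight `WPQ`): normalised
value = the literal `FJ2s3` (kernel evaluation). -/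
theorem pJ2s3 : FS.norm (pairLo (EP.canon (EP.conv GHE H40)) ((WPQ.drop 3).take 4)) = FJ2s3 := by
  decide +kernel

/-- Slice `[7, 16)` of `J`-side pairing 2 (density `canon (GHE ⋆ H40)`, weight `WPQ`): normalised
value = the literal `FJ2s7` (kernel evaluation). -/
theorem pJ2s7 : FS.norm (pairLo (EP.canon (EP.conv GHE H40)) ((WPQ.drop 7).take 9)) = FJ2s7 := by
  decide +kernel

/-- Slice `[16, 21)` of `J`-side pairing 2 (density `canon (GHE ⋆ H40)`, weight `WPQ`): normalised
value = the literal `FJ2s16` (kernel evaluation). -/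
theorem pJ2s16 : FS.norm (pairLo (EP.canon (EP.conv GHE H40)) ((WPQ.drop 16).take 5)) = FJ2s16 := by
  decide +kernel

/-- Slice `[21, 25)` of `J`-side pairing 2 (density `canon (GHE ⋆ H40)`, weight `WPQ`): normalised
value = the literal `FJ2s21` (kernel evaluation). -/
theorem pJ2s21 : FS.norm (pairLo (EP.canon (EP.conv GHE H40)) ((WPQ.drop 21).take 4)) = FJ2s21 := by
  decide +kernel

/-- Kernel evaluation, `J`-side pairing 3 (class C: one factor `h²`), slice `[0, 1)` (blocks of the
weight): the normalised pairing of the density `canon (H2E ⋆ H40)` with the blocks `[0, 1)` of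
`𝖡² = WQ2` on `[0, K]` is the literal `FJ3s0` (`decide +kernel` recomputes the left-hand side; each
pairing is sliced by blocks of its weight so that every kernel check stays well under a minute). -/
theorem pJ3s0 : FS.norm (pairLo (EP.canon (EP.conv H2E H40)) ((WQ2.drop 0).take 1)) = FJ3s0 := by
  decide +kernel

/-- Slice `[1, 3)` of `J`-side pairing 3 (density `canon (H2E ⋆ H40)`, weight `WQ2`): normalised
value = the literal `FJ3s1` (kernel evaluation). -/
theorem pJ3s1 : FS.norm (pairLo (EP.canon (EP.conv H2E H40)) ((WQ2.drop 1).take 2)) = FJ3s1 := by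
  decide +kernel

/-- Slice `[3, 10)` of `J`-side pairing 3 (density `canon (H2E ⋆ H40)`, weight `WQ2`): normalised
value = the literal `FJ3s3` (kernel evaluation). -/
theorem pJ3s3 : FS.norm (pairLo (EP.canon (EP.conv H2E H40)) ((WQ2.drop 3).take 7)) = FJ3s3 := by
  decide +kernel

/-- Bookkeeping (kernel check): the 25 blocks of `WPQ = 𝖠𝖡` are the concatenation of the six slices
used above. -/
theorem WPQ_slices : WPQ = (WPQ.drop 0).take 1 ++ (WPQ.drop 1).take 2 ++ (WPQ.drop 3).take 4 ++ (WPQ.drop 7).take 9 ++ (WPQ.drop 16).take 5 ++ (WPQ.drop 21).take 4 := by decide +kernel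

/-- All slices of class 2. -/
def FJ2all : FS := FJ2s0 ++ FJ2s1 ++ FJ2s3 ++ FJ2s7 ++ FJ2s16 ++ FJ2s21

/-- `J`-side pairing 2 reassembled: `⟦pairLo (canon (GHE ⋆ H40)) WPQ⟧ = ⟦FJ2all⟧` (additivity in the
weight, slice by slice). -/
theorem pJ2 : FS.eval (pairLo (EP.canon (EP.conv GHE H40)) WPQ) = FS.eval FJ2all := by
  rw [WPQ_slices]
  simp only [FJ2all, eval_pairLo_append, FS.eval_append, eval_of_norm_eq pJ2s0, eval_of_norm_eq pJ2s1, eval_of_norm_eq pJ2s3, eval_of_norm_eq pJ2s7, eval_of_norm_eq pJ2s16, eval_of_norm_eq pJ2s21]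

/-- All slices of class 3. -/
def FJ3all : FS := FJ3s0 ++ FJ3s1 ++ FJ3s3

/-- `J`-side pairing 3 reassembled: `⟦pairLo (canon (H2E ⋆ H40)) WQ2⟧ = ⟦FJ3all⟧` (additivity in the
weight, slice by slice). -/
theorem pJ3 : FS.eval (pairLo (EP.canon (EP.conv H2E H40)) WQ2) = FS.eval FJ3all := by
  rw [WQ2_slices]
  simp only [FJ3all, eval_pairLo_append, FS.eval_append, eval_of_norm_eq pJ3s0, eval_of_norm_eq pJ3s1, eval_of_norm_eq pJ3s3]

/-- Kernel identity of formal sums: the total of the four `J`-side class pairings with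
multiplicities `42·(1, 82, 41, 1640)` has the same normal form as the 113-term exact value `jkTerms`
of `Dhl42MainTermsData` (converted to `FS` by `etermsFS`). -/
theorem Jtot : FS.norm (FS.smul 42 FJ1all ++ FS.smul 3444 FJ2all ++ FS.smul 1722 FJ3all ++ FS.smul 68880 FJ4all) =
    FS.norm (etermsFS Dhl42.MainTermsData.jkTerms) := by decide +kernel

end Summit.Parity.GeneralizedHardyLittlewood.Theorems.Dhl42.ClosedForm
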